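import Summits.Ventures.YMGap.Thresholds.TorusStateResponseBound
import Summits.Ventures.YMGap.Thresholds.CouplingDerivativeTools
import HarnessLib

/-!
# Venture YMGap — C-DIFF, part 1: THE RESPONSE SERIES `Σ_q Cov_{β_W}(F, W_q)` of the `SU(2)`, `d = 4`
# strong-coupling state — domination, limit of the torus derivatives (Tannery), continuity in the coupling

HONEST FRAMING: venture file of the cell `pub-ymgap` (QuantumFields programme), seat ds-1.  Strong-coupling LATTICE
statements for `SU(2)` lattice Yang–Mills on `ℤ^4` with the Wilson action inside the one-sided vertex-star window
`0 ≤ β_W ≤ 9/25` (tree bare coupling `β_W/2`, `W_q = ½ Re tr U_q` the normalised plaquette); series estimates only;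
nothing about the continuum, confinement at weak coupling, or the Clay problem.  The derivative theorem itself is the
sibling file `CouplingDerivative`.

For `β₁ ≤ 9/25`, a Lipschitz cylinder `F` (support `Λ`, constant `K`, links based within `D` of `x₀`) and the DLR
state `μ` at `0 ≤ β_W ≤ β₁` (unique by `su2_hasUniqueGibbsMeasure_le_9_25`):
* `su2_tendsto_cov_plaquette` — torus covariances `Cov_{torusState}(F, W_q)` converge to `Cov_μ(F, W_q)`;
* `su2_abs_cov_plaquette_le_star` — `|Cov_μ(F, W_q)| ≤ A r^{‖x₀ − x_q‖₁}` (`A = 4(2√2)² e^{κ(D+3)}(#Λ K)128`,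
  `r = e^{−κ/4}`, `κ = starRate (R_G β₁)`), hence `q ↦ Cov_μ(F, W_q)` is summable (`su2_summable_cov_plaquette_star`);
* `su2_tendsto_responseSum` — the torus derivatives `Σ_{y} Σ_{i<j} Cov_{torusState}(F, W_{(s_L y;i,j)})` (this seat's
  `hasDerivAt_integral_torusState_SU`, centred lifts `s_L`) converge to `Σ_q Cov_μ(F, W_q)` (Tannery's theorem under
  the summable domination of `su2_abs_cov_plaquette_torusState_le`);
* `su2_continuousOn_integral`, `su2_continuousOn_responseSum` — along any DLR selection on `[0, β₁]`, `⟨F⟩_{β_W}` and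
  `Σ_q Cov_{β_W}(F, W_q)` are continuous in `β_W` (C-LIP at the star window for `F·W_q`, `F`, `W_q` + `continuousOn_tsum`).

References (mechanism only): B. Simon, *The Statistical Mechanics of Lattice Gases* I (1993), §II.12;
R. L. Dobrushin, S. B. Shlosman (1985/87).
-/

noncomputable section

open MeasureTheory ProbabilityTheory Function Finset Filter Topology Real Set
open scoped NNReal
open Literature.Probability.LatticeModels (Torus.proj Torus.proj_apply)
open Literature.MathematicalPhysics.QuantumLattice (LGConfig ZdEdge ZdPlaquette plaquetteEdges torusLift torusEdge
  fundamentalRep continuous_fundamentalRep ymSpecification ymGibbsMeasures)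
open Literature.MathematicalPhysics.QuantumFieldTheory hiding ZdEdge
open Summit.Ventures.YMGap.DSWindow (StarWindowBound starRate starRate_pos)
open Summit.Ventures.YMGap.StarWindowGauge (gaugeR gaugeR_lt_one_of_le)
open Summit.Ventures.YMGap.StarLemmaG (gaugeR_nonneg)
open Summit.Ventures.YMGap.StarLimit (continuous_of_isLipschitzCylinder)
open Summit.Ventures.YMGap.RobustBall (l1 numOrient)
open Summit.Ventures.YMGap.LinearResponseBound (summable_and_tsum_base_le)

namespace Summit.Ventures.YMGap.CouplingResponse

/-! ### §1 One plaquette: convergence and domination for DLR states -/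

section OnePlaquette

/-- The plaquette observable `W_q` of `SU(2)` is continuous and bounded by `|W_q 1| + 2·32`. -/
theorem continuous_zdPlaquetteObs_su2 (q : ZdPlaquette 4) :
    Continuous (zdPlaquetteObs (d := 4) (fundamentalRep (Fin 2)) q.1 q.2.1.1 q.2.1.2) ∧
      ∀ U, |zdPlaquetteObs (d := 4) (fundamentalRep (Fin 2)) q.1 q.2.1.1 q.2.1.2 U| ≤
        |zdPlaquetteObs (d := 4) (fundamentalRep (Fin 2)) q.1 q.2.1.1 q.2.1.2 1| + 2 * ((4 * (2 : ℝ≥0) ^ 3 : ℝ≥0) : ℝ) :=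
  ⟨continuous_of_isLipschitzCylinder (isLipschitzCylinder_zdPlaquetteObs (N := 2) q.1 q.2.2),
    fun U => (isLipschitzCylinder_zdPlaquetteObs (N := 2) q.1 q.2.2).abs_le U⟩

/-- **Torus plaquette covariances converge** to those of the unique DLR state, `0 ≤ β_W ≤ 9/25`. -/
theorem su2_tendsto_cov_plaquette {βW : ℝ} (h0 : 0 ≤ βW) (h : βW ≤ 9 / 25)
    {μ : Measure (LGConfig 4 (Matrix.specialUnitaryGroup (Fin 2) ℂ))}
    (hμ : μ ∈ ymGibbsMeasures (d := 4) (fundamentalRep (Fin 2)) (2 * (βW / 4)))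
    {F : LGConfig 4 (Matrix.specialUnitaryGroup (Fin 2) ℂ) → ℝ} {Λ : Finset (ZdEdge 4)} {K : ℝ≥0}
    (hF : IsLipschitzCylinder (fundamentalRep (Fin 2)) F Λ K) (q : ZdPlaquette 4) :
    Tendsto (fun L : ℕ => cov[F, zdPlaquetteObs (fundamentalRep (Fin 2)) q.1 q.2.1.1 q.2.1.2;
        torusState (d := 4) (fundamentalRep (Fin 2)) (βW / 2) (L + 1)]) atTop
      (𝓝 (cov[F, zdPlaquetteObs (fundamentalRep (Fin 2)) q.1 q.2.1.1 q.2.1.2; μ])) := by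
  haveI : SecondCountableTopology (Matrix (Fin 2) (Fin 2) ℂ) :=
    inferInstanceAs (SecondCountableTopology (Fin 2 → Fin 2 → ℂ))
  haveI : SecondCountableTopology (Matrix.specialUnitaryGroup (Fin 2) ℂ) :=
    Topology.IsEmbedding.subtypeVal.secondCountableTopology
  have hu := DSWindowZd.su2_hasUniqueGibbsMeasure_le_9_25 h0 h
  have e : ((2 : ℕ) : ℝ) * (βW / 4) = βW / 2 := by push_cast; ring
  have e' : (2 : ℝ) * (βW / 4) = βW / 2 := by ring
  rw [e] at hu; rw [e'] at hμ
  obtain ⟨hWc, hWb⟩ := continuous_zdPlaquetteObs_su2 q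
  exact tendsto_cov_torusState_of_subsingleton (d := 4) (fundamentalRep (Fin 2)) (continuous_fundamentalRep (Fin 2))
    hu.1 hμ (continuous_of_isLipschitzCylinder hF) hWc (fun U => hF.abs_le U) hWb

/-- **Domination for DLR states**: for `β₁ ≤ 9/25`, `0 ≤ β_W ≤ β₁`, the DLR state `μ` and every plaquette `q`:
`|Cov_μ(F, W_q)| ≤ 4(2√2)² e^{κ(D+3)} (#Λ K) 128 · (e^{−κ/4})^{‖x₀ − x_q‖₁}`, `κ = starRate (R_G β₁)` — the torus
bound `su2_abs_cov_plaquette_torusState_le` on all large tori (centred lift with `s (proj x_q) = x_q`) passed to the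
limit. -/
theorem su2_abs_cov_plaquette_le_star {β₁ : ℝ} (h1 : β₁ ≤ 9 / 25) {βW : ℝ} (h0 : 0 ≤ βW) (hβ : βW ≤ β₁)
    {μ : Measure (LGConfig 4 (Matrix.specialUnitaryGroup (Fin 2) ℂ))}
    (hμ : μ ∈ ymGibbsMeasures (d := 4) (fundamentalRep (Fin 2)) (2 * (βW / 4)))
    {F : LGConfig 4 (Matrix.specialUnitaryGroup (Fin 2) ℂ) → ℝ} {Λ : Finset (ZdEdge 4)} {K : ℝ≥0}
    (hF : IsLipschitzCylinder (fundamentalRep (Fin 2)) F Λ K)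
    {x₀ : Literature.Probability.LatticeModels.Site 4} {D : ℕ} (hD : ∀ e ∈ Λ, ‖e.1 - x₀‖ ≤ D) (q : ZdPlaquette 4) :
    |cov[F, zdPlaquetteObs (fundamentalRep (Fin 2)) q.1 q.2.1.1 q.2.1.2; μ]| ≤
      4 * (2 * Real.sqrt 2) ^ 2 * Real.exp (starRate (gaugeR β₁) * (D + 3)) * ((Λ.card : ℝ) * K) * 128 *
        Real.exp (-(starRate (gaugeR β₁) / 4)) ^ l1 (x₀ - q.1) := by
  have hβ₁0 : 0 ≤ β₁ := h0.trans hβ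
  have hρ0 : 0 ≤ gaugeR β₁ := gaugeR_nonneg hβ₁0 (by linarith)
  have hρ1 : gaugeR β₁ < 1 := gaugeR_lt_one_of_le hβ₁0 h1
  refine le_of_tendsto (su2_tendsto_cov_plaquette h0 (hβ.trans h1) hμ hF q).abs ?_
  filter_upwards [eventually_gt_atTop (max (4 * D + 4)
    (2 * Literature.Probability.LatticeModels.Site.supNorm (q.1 - x₀)))] with L hL
  obtain ⟨s, hs, hcen, hfix⟩ := exists_centredLift (L + 1) x₀ (d := 4)
  have hq : s (Torus.proj (L + 1) q.1) = q.1 := hfix q.1 (by omega)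
  have key := su2_abs_cov_plaquette_torusState_le (L := L + 1) βW hρ0 hρ1
    (su2_starWindowBound_uniform (by omega) h0 hβ h1) hF hD (by omega) hs hcen (Torus.proj (L + 1) q.1) q.2
  rwa [hq] at key

/-- **Summability of the response series** `q ↦ Cov_μ(F, W_q)` for the DLR state at `0 ≤ β_W ≤ β₁ ≤ 9/25`, with
`Σ_q |Cov_μ(F, W_q)| ≤ A · D₄ ((1+r)/(1−r))^4`. -/
theorem su2_summable_cov_plaquette_star {β₁ : ℝ} (h1 : β₁ ≤ 9 / 25) {βW : ℝ} (h0 : 0 ≤ βW) (hβ : βW ≤ β₁)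
    {μ : Measure (LGConfig 4 (Matrix.specialUnitaryGroup (Fin 2) ℂ))}
    (hμ : μ ∈ ymGibbsMeasures (d := 4) (fundamentalRep (Fin 2)) (2 * (βW / 4)))
    {F : LGConfig 4 (Matrix.specialUnitaryGroup (Fin 2) ℂ) → ℝ} {Λ : Finset (ZdEdge 4)} {K : ℝ≥0}
    (hF : IsLipschitzCylinder (fundamentalRep (Fin 2)) F Λ K)
    {x₀ : Literature.Probability.LatticeModels.Site 4} {D : ℕ} (hD : ∀ e ∈ Λ, ‖e.1 - x₀‖ ≤ D) :
    Summable fun q : ZdPlaquette 4 => cov[F, zdPlaquetteObs (fundamentalRep (Fin 2)) q.1 q.2.1.1 q.2.1.2; μ] := by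
  have hβ₁0 : 0 ≤ β₁ := h0.trans hβ
  have hκ := starRate_pos (gaugeR_nonneg hβ₁0 (by linarith)) (gaugeR_lt_one_of_le hβ₁0 h1)
  have hr0 : 0 ≤ Real.exp (-(starRate (gaugeR β₁) / 4)) := (Real.exp_pos _).le
  have hr1 : Real.exp (-(starRate (gaugeR β₁) / 4)) < 1 := Real.exp_lt_one_iff.2 (by linarith)
  have hA : 0 ≤ 4 * (2 * Real.sqrt 2) ^ 2 * Real.exp (starRate (gaugeR β₁) * (D + 3)) * ((Λ.card : ℝ) * K) * 128 := by
    positivity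
  refine Summable.of_norm_bounded (summable_and_tsum_base_le (d := 4) hA hr0 hr1 x₀).1 fun q => ?_
  rw [Real.norm_eq_abs]
  exact su2_abs_cov_plaquette_le_star h1 h0 hβ hμ hF hD q

end OnePlaquette

/-! ### §2 Tannery: the torus derivatives converge to the response series -/

section Tannery

/-- **The torus derivatives converge to the response series** (Tannery's theorem): for `0 ≤ β_W ≤ β₁ ≤ 9/25`, the
DLR state `μ`, and centred lifts `s L` (torus side `L + 1`, centre `x₀`),
`Σ_{y} Σ_{i<j} Cov_{torusState (β_W/2) (L+1)}(F, W_{(s_L y; i,j)}) → Σ_q Cov_μ(F, W_q)` as `L → ∞` — termwise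
convergence (`su2_tendsto_cov_plaquette`, each plaquette eventually inside the fundamental domain) under the
summable domination `A r^{‖x₀ − x_q‖₁}` (`su2_abs_cov_plaquette_torusState_le`). -/
theorem su2_tendsto_responseSum {β₁ : ℝ} (h1 : β₁ ≤ 9 / 25) {βW : ℝ} (h0 : 0 ≤ βW) (hβ : βW ≤ β₁)
    {μ : Measure (LGConfig 4 (Matrix.specialUnitaryGroup (Fin 2) ℂ))}
    (hμ : μ ∈ ymGibbsMeasures (d := 4) (fundamentalRep (Fin 2)) (2 * (βW / 4)))
    {F : LGConfig 4 (Matrix.specialUnitaryGroup (Fin 2) ℂ) → ℝ} {Λ : Finset (ZdEdge 4)} {K : ℝ≥0}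
    (hF : IsLipschitzCylinder (fundamentalRep (Fin 2)) F Λ K)
    {x₀ : Literature.Probability.LatticeModels.Site 4} {D : ℕ} (hD : ∀ e ∈ Λ, ‖e.1 - x₀‖ ≤ D)
    (s : ∀ L : ℕ, Site 4 (L + 1) → Literature.Probability.LatticeModels.Site 4)
    (hs : ∀ L y, (Torus.proj (L + 1) (s L y) : Site 4 (L + 1)) = y)
    (hcen : ∀ L y, torusNorm (y - Torus.proj (L + 1) x₀) = Literature.Probability.LatticeModels.Site.supNorm (s L y - x₀))
    (hfix : ∀ L x, 2 * Literature.Probability.LatticeModels.Site.supNorm (x - x₀) < L + 1 → s L (Torus.proj (L + 1) x) = x) :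
    Tendsto (fun L : ℕ => ∑ y : Site 4 (L + 1), ∑ p : {p : Fin 4 × Fin 4 // p.1 < p.2},
        cov[F, zdPlaquetteObs (fundamentalRep (Fin 2)) (s L y) p.1.1 p.1.2;
          torusState (d := 4) (fundamentalRep (Fin 2)) (βW / 2) (L + 1)]) atTop
      (𝓝 (∑' q : ZdPlaquette 4, cov[F, zdPlaquetteObs (fundamentalRep (Fin 2)) q.1 q.2.1.1 q.2.1.2; μ])) := by
  classical
  have hβ₁0 : 0 ≤ β₁ := h0.trans hβ
  have hρ0 : 0 ≤ gaugeR β₁ := gaugeR_nonneg hβ₁0 (by linarith)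
  have hρ1 : gaugeR β₁ < 1 := gaugeR_lt_one_of_le hβ₁0 h1
  have hκ := starRate_pos hρ0 hρ1
  set r : ℝ := Real.exp (-(starRate (gaugeR β₁) / 4)) with hr
  set A : ℝ := 4 * (2 * Real.sqrt 2) ^ 2 * Real.exp (starRate (gaugeR β₁) * (D + 3)) * ((Λ.card : ℝ) * K) * 128
    with hA
  have hr0 : 0 ≤ r := (Real.exp_pos _).le
  have hr1 : r < 1 := Real.exp_lt_one_iff.2 (by linarith)
  have hA0 : 0 ≤ A := by positivity
  -- the covariances as functions on all plaquettes of `ℤ^4`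
  set c : ℕ → ZdPlaquette 4 → ℝ := fun L q =>
    cov[F, zdPlaquetteObs (fundamentalRep (Fin 2)) q.1 q.2.1.1 q.2.1.2;
      torusState (d := 4) (fundamentalRep (Fin 2)) (βW / 2) (L + 1)] with hc
  set f : ℕ → ZdPlaquette 4 → ℝ := fun L q =>
    if q.1 ∈ (Finset.univ : Finset (Site 4 (L + 1))).image (s L) then c L q else 0 with hf
  have hsinj : ∀ L, Function.Injective (s L) := fun L y y' h => by rw [← hs L y, ← hs L y', h]
  -- the finite double sum is the `tsum` of `f L`
  have hsum : ∀ L, ∑ y : Site 4 (L + 1), ∑ p : {p : Fin 4 × Fin 4 // p.1 < p.2}, c L (s L y, p) = ∑' q, f L q := by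
    intro L
    set S := (Finset.univ : Finset (Site 4 (L + 1))).image (s L) with hS
    rw [tsum_eq_sum (s := S ×ˢ (Finset.univ : Finset {p : Fin 4 × Fin 4 // p.1 < p.2}))]
    · rw [Finset.sum_product, Finset.sum_image fun y _ y' _ h => hsinj L h]
      refine Finset.sum_congr rfl fun y _ => Finset.sum_congr rfl fun p _ => ?_
      rw [hf]
      simp only
      rw [if_pos (Finset.mem_image_of_mem _ (Finset.mem_univ y))]
    · intro q hq
      rw [hf]
      simp only
      rw [if_neg]
      intro hq1
      exact hq (Finset.mem_product.2 ⟨hq1, Finset.mem_univ _⟩)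
  have hsum' : (fun L : ℕ => ∑ y : Site 4 (L + 1), ∑ p : {p : Fin 4 × Fin 4 // p.1 < p.2},
      cov[F, zdPlaquetteObs (fundamentalRep (Fin 2)) (s L y) p.1.1 p.1.2;
        torusState (d := 4) (fundamentalRep (Fin 2)) (βW / 2) (L + 1)]) = fun L => ∑' q, f L q := by
    funext L; exact hsum L
  rw [hsum']
  refine tendsto_tsum_of_dominated_convergence (bound := fun q : ZdPlaquette 4 => A * r ^ l1 (x₀ - q.1))
    (summable_and_tsum_base_le (d := 4) hA0 hr0 hr1 x₀).1 (fun q => ?_) ?_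
  · -- termwise: eventually `q` lies in the fundamental domain, then torus covariances converge
    have hev : ∀ᶠ L : ℕ in atTop, f L q = c L q := by
      filter_upwards [eventually_gt_atTop (2 * Literature.Probability.LatticeModels.Site.supNorm (q.1 - x₀))] with L hL
      have hq : s L (Torus.proj (L + 1) q.1) = q.1 := hfix L q.1 (by omega)
      have hmem : q.1 ∈ (Finset.univ : Finset (Site 4 (L + 1))).image (s L) :=
        Finset.mem_image.2 ⟨Torus.proj (L + 1) q.1, Finset.mem_univ _, hq⟩
      rw [hf]; simp only; rw [if_pos hmem]
    refine Tendsto.congr' (EventuallyEq.symm hev) ?_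
    exact su2_tendsto_cov_plaquette h0 (hβ.trans h1) hμ hF q
  · -- domination on every torus of side `> 4D + 4`
    filter_upwards [eventually_gt_atTop (4 * D + 4)] with L hL q
    rw [hf]; simp only
    split_ifs with hmem
    · obtain ⟨y, -, hy⟩ := Finset.mem_image.1 hmem
      rw [Real.norm_eq_abs, hc]; simp only
      rw [← hy]
      exact su2_abs_cov_plaquette_torusState_le (L := L + 1) βW hρ0 hρ1
        (su2_starWindowBound_uniform (by omega) h0 hβ h1) hF hD (by omega) (hs L) (hcen L) y q.2
    · rw [norm_zero]; positivity

end Tannery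

/-! ### §3 Continuity of the response series in the coupling -/

section Continuity

/-- A real function with `|f x − f y| ≤ C|x − y|` on `s` is continuous on `s`. [folklore] -/
theorem continuousOn_of_abs_sub_le {f : ℝ → ℝ} {s : Set ℝ} {C : ℝ}
    (h : ∀ x ∈ s, ∀ y ∈ s, |f x - f y| ≤ C * |x - y|) : ContinuousOn f s := by
  refine Metric.continuousOn_iff.2 fun b hb ε hε => ⟨ε / (|C| + 1), by positivity, fun a ha hab => ?_⟩
  rw [Real.dist_eq] at hab ⊢
  have hC : C * |a - b| ≤ (|C| + 1) * |a - b| := mul_le_mul_of_nonneg_right ((le_abs_self C).trans (by linarith)) (abs_nonneg _)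
  calc |f a - f b| ≤ (|C| + 1) * |a - b| := (h a ha b hb).trans hC
    _ < (|C| + 1) * (ε / (|C| + 1)) := mul_lt_mul_of_pos_left hab (by positivity)
    _ = ε := mul_div_cancel₀ ε (by positivity)

/-- **Expectations of Lipschitz cylinders are continuous in the coupling along any DLR selection** on `[0, β₁]`,
`β₁ ≤ 9/25` (C-LIP at the star window). -/
theorem su2_continuousOn_integral {β₁ : ℝ} (h1 : β₁ ≤ 9 / 25)
    {μ : ℝ → Measure (LGConfig 4 (Matrix.specialUnitaryGroup (Fin 2) ℂ))}
    (hμ : ∀ βW ∈ Icc (0 : ℝ) β₁, μ βW ∈ ymGibbsMeasures (d := 4) (fundamentalRep (Fin 2)) (2 * (βW / 4)))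
    {F : LGConfig 4 (Matrix.specialUnitaryGroup (Fin 2) ℂ) → ℝ} {Λ : Finset (ZdEdge 4)} {K : ℝ≥0}
    (hF : IsLipschitzCylinder (fundamentalRep (Fin 2)) F Λ K)
    {x₀ : Literature.Probability.LatticeModels.Site 4} {D : ℕ} (hD : ∀ e ∈ Λ, ‖e.1 - x₀‖ ≤ D) :
    ContinuousOn (fun βW => ∫ U, F U ∂(μ βW)) (Icc (0 : ℝ) β₁) :=
  continuousOn_of_abs_sub_le fun b hb b' hb' =>
    su2_abs_integral_sub_integral_le_star h1 hb.1 hb.2 hb'.1 hb'.2 (hμ b hb) (hμ b' hb') hF hD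

/-- **The response series is continuous in the coupling**: along any DLR selection on `[0, β₁]`, `β₁ ≤ 9/25`,
`β_W ↦ Σ_q Cov_{μ β_W}(F, W_q)` is continuous on `[0, β₁]` — each term is continuous (C-LIP at the star window for
`F·W_q`, `F`, `W_q`) and the series is dominated uniformly by the summable `A r^{‖x₀ − x_q‖₁}` (`continuousOn_tsum`). -/
theorem su2_continuousOn_responseSum {β₁ : ℝ} (h1 : β₁ ≤ 9 / 25)
    {μ : ℝ → Measure (LGConfig 4 (Matrix.specialUnitaryGroup (Fin 2) ℂ))}
    (hμ : ∀ βW ∈ Icc (0 : ℝ) β₁, μ βW ∈ ymGibbsMeasures (d := 4) (fundamentalRep (Fin 2)) (2 * (βW / 4)))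
    {F : LGConfig 4 (Matrix.specialUnitaryGroup (Fin 2) ℂ) → ℝ} {Λ : Finset (ZdEdge 4)} {K : ℝ≥0}
    (hF : IsLipschitzCylinder (fundamentalRep (Fin 2)) F Λ K)
    {x₀ : Literature.Probability.LatticeModels.Site 4} {D : ℕ} (hD : ∀ e ∈ Λ, ‖e.1 - x₀‖ ≤ D) :
    ContinuousOn (fun βW => ∑' q : ZdPlaquette 4,
      cov[F, zdPlaquetteObs (fundamentalRep (Fin 2)) q.1 q.2.1.1 q.2.1.2; μ βW]) (Icc (0 : ℝ) β₁) := by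
  classical
  rcases lt_or_ge β₁ 0 with hneg | hβ₁0
  · rw [Set.Icc_eq_empty (by simpa using hneg)]; exact continuousOn_empty _
  have hρ0 : 0 ≤ gaugeR β₁ := gaugeR_nonneg hβ₁0 (by linarith)
  have hρ1 : gaugeR β₁ < 1 := gaugeR_lt_one_of_le hβ₁0 h1
  have hκ := starRate_pos hρ0 hρ1
  have hr0 : 0 ≤ Real.exp (-(starRate (gaugeR β₁) / 4)) := (Real.exp_pos _).le
  have hr1 : Real.exp (-(starRate (gaugeR β₁) / 4)) < 1 := Real.exp_lt_one_iff.2 (by linarith)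
  have hA : 0 ≤ 4 * (2 * Real.sqrt 2) ^ 2 * Real.exp (starRate (gaugeR β₁) * (D + 3)) * ((Λ.card : ℝ) * K) * 128 := by
    positivity
  refine continuousOn_tsum (fun q => ?_) (summable_and_tsum_base_le (d := 4) hA hr0 hr1 x₀).1
    (fun q βW hb => ?_)
  · -- one term: `Cov = ∫FW − ∫F ∫W`, each continuous by C-LIP at the star window
    have hW := isLipschitzCylinder_zdPlaquetteObs (N := 2) (d := 4) q.1 q.2.2
    obtain ⟨hWc, hWb⟩ := continuous_zdPlaquetteObs_su2 q
    have hFb : ∀ U, |F U| ≤ |F 1| + 2 * K := fun U => hF.abs_le U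
    -- supports within `D' = D + ‖x_q − x₀‖ + 1` of `x₀`
    set D' : ℕ := D + Literature.Probability.LatticeModels.Site.supNorm (q.1 - x₀) + 1 with hD'
    have hDq : ∀ e ∈ plaquetteEdges q, ‖e.1 - x₀‖ ≤ D' := by
      intro e he
      have h1' : ‖e.1 - q.1‖ ≤ 1 := norm_fst_sub_le_of_mem_plaquetteEdges he
      have h2' : ‖q.1 - x₀‖ = Literature.Probability.LatticeModels.Site.supNorm (q.1 - x₀) :=
        Literature.Probability.LatticeModels.Site.norm_eq_supNorm _
      calc ‖e.1 - x₀‖ = ‖(e.1 - q.1) + (q.1 - x₀)‖ := by congr 1; abel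
        _ ≤ ‖e.1 - q.1‖ + ‖q.1 - x₀‖ := norm_add_le _ _
        _ ≤ D' := by rw [hD']; push_cast; linarith
    have hDΛ : ∀ e ∈ Λ, ‖e.1 - x₀‖ ≤ D' := fun e he => (hD e he).trans (by rw [hD']; push_cast; linarith)
    have hDU : ∀ e ∈ Λ ∪ plaquetteEdges q, ‖e.1 - x₀‖ ≤ D' := fun e he => by
      rcases Finset.mem_union.1 he with h | h
      · exact hDΛ e h
      · exact hDq e h
    have hFW := isLipschitzCylinder_mul (M₁ := ⟨|F 1| + 2 * K, by positivity⟩)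
      (M₂ := ⟨|zdPlaquetteObs (d := 4) (fundamentalRep (Fin 2)) q.1 q.2.1.1 q.2.1.2 1| +
        2 * ((4 * (2 : ℝ≥0) ^ 3 : ℝ≥0) : ℝ), by positivity⟩) hF hW hFb hWb
    have c1 := su2_continuousOn_integral h1 hμ hFW hDU
    have c2 := su2_continuousOn_integral h1 hμ hF hDΛ
    have c3 := su2_continuousOn_integral h1 hμ hW hDq
    refine ((c1.sub (c2.mul c3)).congr fun βW hb => ?_)
    haveI : IsProbabilityMeasure (μ βW) := (hμ βW hb).1
    exact covariance_eq_sub_of_abs_le hF.measurable hW.measurable hFb hWb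
  · rw [Real.norm_eq_abs]
    exact su2_abs_cov_plaquette_le_star h1 hb.1 hb.2 (hμ βW hb) hF hD q

end Continuity

end Summit.Ventures.YMGap.CouplingResponse

end
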